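import Literature.Analysis.Complex.RiemannDomainMeasure
import Mathlib.Geometry.Manifold.SmoothApprox
import Mathlib.MeasureTheory.Function.ContinuousMapDense
import Mathlib.Topology.Metrizable.Urysohn
import HarnessLib

/-!
# Test functions on a Riemann domain: algebra, integration by parts, chart transport, density

Layer `Literature/Analysis/Complex`; continues `RiemannDomain.lean` / `RiemannDomainMeasure.lean`
(Hörmander, *An Introduction to Complex Analysis in Several Variables* (1973), §4.1–4.2 on a space
`D` spread over `ℂ^ι` by a local homeomorphism, Def. 5.4.4). The spaces `C₀^∞(Ω)` resp.
`D_{(p,q)}(Ω)` of the `L²` method (p. 77, p. 83) are, on `D`, the compactly supported functions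
that are `C^∞` for the flat structure:

* `IsTest u` — `u : D → G` is `C^∞` (flat structure) with compact support; the algebra
  (`add`, `smul` by smooth functions, `conj`, finite sums), flat derivatives of test functions are
  test functions (`IsTest.fderivF_apply`, `IsTest.del`, `IsTest.dbar`);
* **integration by parts** «`∫ w₁ (∂w₂/∂z̄_k)‾ e^{-φ} dλ = -∫ …`» (p. 83) in the primitive forms
  `integral_mul_dbar_eq_neg` / `integral_mul_del_eq_neg` / `integral_mul_fderivF_apply_eq_neg`:
  `∫ u ∂̄_v w d vol = -∫ (∂̄_v u) w d vol` for `u` smooth and `w` a test function (from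
  `∫ ∂̄ (u w) = 0`, `RiemannDomainMeasure`);
* **chart transport**: a test function supported in the source of a local inverse `e` of `proj`
  is a test function on `ℂ^ι` supported in `e.target` (`RiemannDomainMeasure.contDiff_indicator_comp_symm`)
  and conversely (`isTest_indicator_comp_proj`), with the derivative dictionary
  (`dbar_indicator_comp_proj`, …);
* **smooth cut-offs** with values in `[0, 1]`, equal to `1` near a compact set and supported in a
  given open set (`exists_contMDiff_cutoff`, `exists_cutoff_eq_one`), and an exhausting sequence of
  them (`exists_cutoff_seq`);
* **density**: test functions are dense in `L^p(D, μ)`, `1 ≤ p < ∞`, for EVERY measure `μ` on `D`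
  finite on compact sets (`exists_isTest_eLpNorm_sub_le`; Hörmander p. 77: «`D_{(p,q)}(Ω)` is
  dense in `L²_{(p,q)}(Ω, φ)`») — `D` is metrizable and σ-compact, so `μ` is regular and
  continuous compactly supported functions are dense (Mathlib
  `MemLp.exists_hasCompactSupport_eLpNorm_sub_le`); these are uniformly approximated by `C^∞`
  functions with the same support (Mathlib `Continuous.exists_contMDiff_approx`).

Everything is proved; the only definition is the predicate `IsTest`; no named facts.

## References

* L. Hörmander, *An Introduction to Complex Analysis in Several Variables*, 2nd ed. (1973), §4.1
  (p. 77: density of `D_{(p,q)}` in `L²_{(p,q)}(Ω, φ)`), §4.2 (p. 83: integration by parts),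
  Def. 5.4.4. [HormanderSCV1973]

#harness_tags complex_analysis.several_variables, complex_analysis.l2_estimates, complex_geometry.riemann_existence
-/

noncomputable section

open scoped Manifold ContDiff Topology ComplexConjugate
open Set Filter Function Complex OpenPartialHomeomorph MeasureTheory MeasureTheory.Measure

namespace Literature.Analysis.Complex

namespace RiemannDomain

universe u

variable {ι : Type} [Fintype ι] {D : RiemannDomain.{u} ι}
variable {G : Type*} [NormedAddCommGroup G] [NormedSpace ℂ G]

/-! ### Test functions -/

/-- **Test functions on a Riemann domain** (`C₀^∞` for the flat structure): `u : D → G` is `C^∞`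
with compact support. [cite: HormanderSCV1973, §4.1 (p. 77, the spaces `D_{(p,q)}(Ω)`)] -/
structure IsTest (u : D → G) : Prop where
  /-- a test function is `C^∞` for the flat structure -/
  contMDiff : ContMDiff 𝓘(ℝ, ι → ℂ) 𝓘(ℝ, G) ∞ u
  /-- a test function has compact support -/
  hasCompactSupport : HasCompactSupport u

namespace IsTest

variable {u w : D → G}

/-- A test function is continuous. [folklore] -/
theorem continuous (hu : IsTest u) : Continuous u := hu.contMDiff.continuous

/-- A test function is integrable for every measure finite on compact sets. [folklore] -/
theorem integrable (hu : IsTest u) (μ : Measure D) [IsFiniteMeasureOnCompacts μ] : Integrable u μ :=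
  hu.continuous.integrable_of_hasCompactSupport hu.hasCompactSupport

/-- A test function is in every `L^p` for every measure finite on compact sets. [folklore] -/
theorem memLp (hu : IsTest u) (p : ENNReal) (μ : Measure D) [IsFiniteMeasureOnCompacts μ] :
    MemLp u p μ :=
  hu.continuous.memLp_of_hasCompactSupport hu.hasCompactSupport

/-- The zero function is a test function. [folklore] -/
theorem zero : IsTest (0 : D → G) := ⟨contMDiff_const, HasCompactSupport.zero⟩

/-- The zero function is a test function (lambda form). [folklore] -/
theorem zero' : IsTest (fun _ : D ↦ (0 : G)) := zero

/-- Sums of test functions are test functions. [folklore] -/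
theorem add (hu : IsTest u) (hw : IsTest w) : IsTest (u + w) :=
  ⟨hu.contMDiff.add hw.contMDiff, hu.hasCompactSupport.add hw.hasCompactSupport⟩

/-- Sums of test functions are test functions (lambda form). [folklore] -/
theorem add' (hu : IsTest u) (hw : IsTest w) : IsTest fun x ↦ u x + w x := hu.add hw

/-- Negatives of test functions are test functions. [folklore] -/
theorem neg (hu : IsTest u) : IsTest (-u) := ⟨hu.contMDiff.neg, HasCompactSupport.neg hu.hasCompactSupport⟩

/-- Negatives of test functions are test functions (lambda form). [folklore] -/
theorem neg' (hu : IsTest u) : IsTest fun x ↦ -u x := hu.neg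

/-- Differences of test functions are test functions. [folklore] -/
theorem sub (hu : IsTest u) (hw : IsTest w) : IsTest (u - w) := by
  rw [sub_eq_add_neg]; exact hu.add hw.neg

/-- Differences of test functions are test functions (lambda form). [folklore] -/
theorem sub' (hu : IsTest u) (hw : IsTest w) : IsTest fun x ↦ u x - w x := hu.sub hw

/-- Constant multiples of test functions are test functions. [folklore] -/
theorem const_smul (hu : IsTest u) (c : ℂ) : IsTest fun x ↦ c • u x :=
  ⟨(contDiff_const_smul c).comp_contMDiff hu.contMDiff, hu.hasCompactSupport.smul_left⟩

/-- Finite sums of test functions are test functions. [folklore] -/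
theorem sum {α : Type*} {s : Finset α} {g : α → D → G} (hg : ∀ a ∈ s, IsTest (g a)) :
    IsTest fun x ↦ ∑ a ∈ s, g a x := by
  classical
  induction s using Finset.induction_on with
  | empty => simpa using zero'
  | insert a s ha ih =>
    have h := (hg a (Finset.mem_insert_self a s)).add' (ih fun b hb ↦ hg b (Finset.mem_insert_of_mem hb))
    refine ⟨h.contMDiff.congr fun x ↦ ?_, h.hasCompactSupport.mono fun x hx ↦ ?_⟩
    · exact Finset.sum_insert ha
    · rwa [mem_support, Finset.sum_insert ha] at hx

end IsTest

/-! ### Products with smooth functions -/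

section Products

variable {χ : D → ℂ} {u : D → G}

/-- The product of a `C^∞` scalar function and a `C^∞` vector function is `C^∞` (flat structure;
via the smooth bilinear map `ℂ × G → G`). [folklore] -/
theorem contMDiff_smul (hχ : ContMDiff 𝓘(ℝ, ι → ℂ) 𝓘(ℝ, ℂ) ∞ χ) (hu : ContMDiff 𝓘(ℝ, ι → ℂ) 𝓘(ℝ, G) ∞ u) :
    ContMDiff 𝓘(ℝ, ι → ℂ) 𝓘(ℝ, G) ∞ fun x ↦ χ x • u x := by
  have h : ContDiff ℝ ∞ fun p : ℂ × G ↦ p.1 • p.2 := (contDiff_smul (𝕜 := ℂ)).restrict_scalars ℝ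
  exact h.comp_contMDiff (hχ.prodMk_space hu)

/-- The product of two `C^∞` scalar functions is `C^∞` (flat structure). [folklore] -/
theorem contMDiff_mul {χ u : D → ℂ} (hχ : ContMDiff 𝓘(ℝ, ι → ℂ) 𝓘(ℝ, ℂ) ∞ χ)
    (hu : ContMDiff 𝓘(ℝ, ι → ℂ) 𝓘(ℝ, ℂ) ∞ u) : ContMDiff 𝓘(ℝ, ι → ℂ) 𝓘(ℝ, ℂ) ∞ fun x ↦ χ x * u x :=
  contMDiff_smul hχ hu

/-- The conjugate of a `C^∞` scalar function is `C^∞` (flat structure). [folklore] -/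
theorem contMDiff_conj {u : D → ℂ} (hu : ContMDiff 𝓘(ℝ, ι → ℂ) 𝓘(ℝ, ℂ) ∞ u) :
    ContMDiff 𝓘(ℝ, ι → ℂ) 𝓘(ℝ, ℂ) ∞ fun x ↦ conj (u x) :=
  (conjCLE.contDiff.of_le le_top).comp_contMDiff hu

/-- A real `C^∞` function read in `ℂ` is `C^∞`. [folklore] -/
theorem contMDiff_ofReal {u : D → ℝ} (hu : ContMDiff 𝓘(ℝ, ι → ℂ) 𝓘(ℝ, ℝ) ∞ u) :
    ContMDiff 𝓘(ℝ, ι → ℂ) 𝓘(ℝ, ℂ) ∞ fun x ↦ (u x : ℂ) :=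
  (ofRealCLM.contDiff.of_le le_top).comp_contMDiff hu

/-- The exponential of a real `C^∞` function is `C^∞`. [folklore] -/
theorem contMDiff_exp {u : D → ℝ} (hu : ContMDiff 𝓘(ℝ, ι → ℂ) 𝓘(ℝ, ℝ) ∞ u) :
    ContMDiff 𝓘(ℝ, ι → ℂ) 𝓘(ℝ, ℝ) ∞ fun x ↦ Real.exp (u x) :=
  (Real.contDiff_exp.of_le le_top).comp_contMDiff hu

/-- `χ • u` is a test function for `χ` smooth and `u` a test function. [folklore] -/
theorem IsTest.smul_left (hχ : ContMDiff 𝓘(ℝ, ι → ℂ) 𝓘(ℝ, ℂ) ∞ χ) (hu : IsTest u) :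
    IsTest fun x ↦ χ x • u x :=
  ⟨contMDiff_smul hχ hu.contMDiff, hu.hasCompactSupport.smul_left⟩

/-- `χ • u` is a test function for `χ` a test function and `u` smooth. [folklore] -/
theorem IsTest.smul_right (hχ : IsTest χ) (hu : ContMDiff 𝓘(ℝ, ι → ℂ) 𝓘(ℝ, G) ∞ u) :
    IsTest fun x ↦ χ x • u x :=
  ⟨contMDiff_smul hχ.contMDiff hu, hχ.hasCompactSupport.smul_right⟩

/-- `χ u` is a test function for `χ` smooth and `u` a scalar test function. [folklore] -/
theorem IsTest.mul_left {u : D → ℂ} (hχ : ContMDiff 𝓘(ℝ, ι → ℂ) 𝓘(ℝ, ℂ) ∞ χ) (hu : IsTest u) :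
    IsTest fun x ↦ χ x * u x :=
  hu.smul_left hχ

/-- `χ u` is a test function for `χ` a scalar test function and `u` smooth. [folklore] -/
theorem IsTest.mul_right {u : D → ℂ} (hχ : IsTest χ) (hu : ContMDiff 𝓘(ℝ, ι → ℂ) 𝓘(ℝ, ℂ) ∞ u) :
    IsTest fun x ↦ χ x * u x :=
  hχ.smul_right hu

/-- The conjugate of a scalar test function is a test function. [folklore] -/
theorem IsTest.conj {u : D → ℂ} (hu : IsTest u) : IsTest fun x ↦ conj (u x) :=
  ⟨contMDiff_conj hu.contMDiff, by
    refine hu.hasCompactSupport.mono fun x hx ↦ ?_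
    rw [mem_support] at hx ⊢
    exact fun h ↦ hx (by rw [h, map_zero])⟩

/-- A real test function read in `ℂ` is a test function. [folklore] -/
theorem IsTest.ofReal {u : D → ℝ} (hu : ContMDiff 𝓘(ℝ, ι → ℂ) 𝓘(ℝ, ℝ) ∞ u) (hc : HasCompactSupport u) :
    IsTest fun x ↦ (u x : ℂ) :=
  ⟨contMDiff_ofReal hu, by
    refine hc.mono fun x hx ↦ ?_
    rw [mem_support] at hx ⊢
    exact fun h ↦ hx (by exact_mod_cast h)⟩

end Products

/-! ### Flat derivatives of test functions -/

namespace IsTest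

variable {u : D → G}

/-- `x ↦ D u x (v)` is a test function for `u` a test function. [folklore] -/
theorem fderivF_apply (hu : IsTest u) (v : ι → ℂ) : IsTest fun x ↦ fderivF u x v :=
  ⟨contMDiff_fderivF_apply hu.contMDiff v, hu.hasCompactSupport.mono' (support_fderivF_apply_subset u v)⟩

/-- `∂_v u` is a test function for `u` a test function. [folklore] -/
theorem del (hu : IsTest u) (v : ι → ℂ) : IsTest (del v u) := by
  have h : RiemannDomain.del v u = fun x ↦ (2 : ℂ)⁻¹ • (fderivF u x v - I • fderivF u x (I • v)) := rfl
  rw [h]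
  exact ((hu.fderivF_apply v).sub' (((hu.fderivF_apply (I • v))).const_smul I)).const_smul _

/-- `∂̄_v u` is a test function for `u` a test function. [folklore] -/
theorem dbar (hu : IsTest u) (v : ι → ℂ) : IsTest (dbar v u) := by
  have h : RiemannDomain.dbar v u = fun x ↦ (2 : ℂ)⁻¹ • (fderivF u x v + I • fderivF u x (I • v)) := rfl
  rw [h]
  exact ((hu.fderivF_apply v).add' (((hu.fderivF_apply (I • v))).const_smul I)).const_smul _

end IsTest

/-- Differentiability of the local representative of a `C^∞` function at any point. [folklore] -/
theorem differentiableAt_comp_symm_of_contMDiff {u : D → G} (hu : ContMDiff 𝓘(ℝ, ι → ℂ) 𝓘(ℝ, G) ∞ u)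
    (x : D) : DifferentiableAt ℝ (u ∘ (D.chart x).symm) (D.proj x) :=
  differentiableAt_comp_symm (hu x) (by simp)

/-! ### Integration by parts against test functions -/

section IBP

variable {u w : D → ℂ}

/-- **`∫ u · D w (v) d vol = -∫ D u (v) · w d vol`** for `u` smooth and `w` a test function.
[cite: HormanderSCV1973, §4.2 p. 83] -/
theorem integral_mul_fderivF_apply_eq_neg (hu : ContMDiff 𝓘(ℝ, ι → ℂ) 𝓘(ℝ, ℂ) ∞ u) (hw : IsTest w)
    (v : ι → ℂ) : ∫ x, u x * fderivF w x v ∂D.vol = -∫ x, fderivF u x v * w x ∂D.vol := by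
  have hprod : IsTest fun x ↦ u x * w x := hw.mul_left hu
  have h0 := integral_fderivF_apply_eq_zero hprod.contMDiff hprod.hasCompactSupport v
  have hpt : ∀ x, fderivF (fun y ↦ u y * w y) x v = u x * fderivF w x v + fderivF u x v * w x := fun x ↦ by
    have := fderivF_smul (differentiableAt_comp_symm_of_contMDiff hu x)
      (differentiableAt_comp_symm_of_contMDiff hw.contMDiff x) v
    simpa only [smul_eq_mul] using this
  simp_rw [hpt] at h0
  have hi1 : Integrable (fun x ↦ u x * fderivF w x v) D.vol :=
    ((hw.fderivF_apply v).mul_left hu).integrable _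
  have hi2 : Integrable (fun x ↦ fderivF u x v * w x) D.vol := by
    have : IsTest fun x ↦ w x * fderivF u x v := hw.mul_right (contMDiff_fderivF_apply hu v)
    exact (this.integrable _).congr (ae_of_all _ fun x ↦ mul_comm _ _)
  rw [integral_add hi1 hi2] at h0
  linear_combination h0

/-- **`∫ u ∂̄_v w d vol = -∫ (∂̄_v u) w d vol`** for `u` smooth and `w` a test function (Hörmander
p. 83, the adjointness of `∂/∂z̄_k` and `-δ_k` on `C₀^∞`, unweighted primitive form).
[cite: HormanderSCV1973, §4.2 p. 83] -/
theorem integral_mul_dbar_eq_neg (hu : ContMDiff 𝓘(ℝ, ι → ℂ) 𝓘(ℝ, ℂ) ∞ u) (hw : IsTest w) (v : ι → ℂ) :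
    ∫ x, u x * dbar v w x ∂D.vol = -∫ x, dbar v u x * w x ∂D.vol := by
  have hi : ∀ v', Integrable (fun x ↦ u x * fderivF w x v') D.vol := fun v' ↦
    ((hw.fderivF_apply v').mul_left hu).integrable _
  have hi' : ∀ v', Integrable (fun x ↦ fderivF u x v' * w x) D.vol := fun v' ↦ by
    have : IsTest fun x ↦ w x * fderivF u x v' := hw.mul_right (contMDiff_fderivF_apply hu v')
    exact (this.integrable _).congr (ae_of_all _ fun x ↦ mul_comm _ _)
  simp only [dbar_eq_fderivF, smul_eq_mul]
  have e1 : ∀ x, u x * (2⁻¹ * (fderivF w x v + I * fderivF w x (I • v))) =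
      2⁻¹ * (u x * fderivF w x v) + (2⁻¹ * I) * (u x * fderivF w x (I • v)) := fun x ↦ by ring
  have e2 : ∀ x, 2⁻¹ * (fderivF u x v + I * fderivF u x (I • v)) * w x =
      2⁻¹ * (fderivF u x v * w x) + (2⁻¹ * I) * (fderivF u x (I • v) * w x) := fun x ↦ by ring
  simp_rw [e1, e2]
  rw [integral_add ((hi v).const_mul _) ((hi _).const_mul _), integral_add ((hi' v).const_mul _)
    ((hi' _).const_mul _), integral_const_mul, integral_const_mul, integral_const_mul, integral_const_mul,
    integral_mul_fderivF_apply_eq_neg hu hw v, integral_mul_fderivF_apply_eq_neg hu hw (I • v)]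
  ring

/-- **`∫ u ∂_v w d vol = -∫ (∂_v u) w d vol`** for `u` smooth and `w` a test function.
[cite: HormanderSCV1973, §4.2 p. 83] -/
theorem integral_mul_del_eq_neg (hu : ContMDiff 𝓘(ℝ, ι → ℂ) 𝓘(ℝ, ℂ) ∞ u) (hw : IsTest w) (v : ι → ℂ) :
    ∫ x, u x * del v w x ∂D.vol = -∫ x, del v u x * w x ∂D.vol := by
  have hi : ∀ v', Integrable (fun x ↦ u x * fderivF w x v') D.vol := fun v' ↦
    ((hw.fderivF_apply v').mul_left hu).integrable _
  have hi' : ∀ v', Integrable (fun x ↦ fderivF u x v' * w x) D.vol := fun v' ↦ by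
    have : IsTest fun x ↦ w x * fderivF u x v' := hw.mul_right (contMDiff_fderivF_apply hu v')
    exact (this.integrable _).congr (ae_of_all _ fun x ↦ mul_comm _ _)
  simp only [del_eq_fderivF, smul_eq_mul]
  have e1 : ∀ x, u x * (2⁻¹ * (fderivF w x v - I * fderivF w x (I • v))) =
      2⁻¹ * (u x * fderivF w x v) - (2⁻¹ * I) * (u x * fderivF w x (I • v)) := fun x ↦ by ring
  have e2 : ∀ x, 2⁻¹ * (fderivF u x v - I * fderivF u x (I • v)) * w x =
      2⁻¹ * (fderivF u x v * w x) - (2⁻¹ * I) * (fderivF u x (I • v) * w x) := fun x ↦ by ring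
  simp_rw [e1, e2]
  rw [integral_sub ((hi v).const_mul _) ((hi _).const_mul _), integral_sub ((hi' v).const_mul _)
    ((hi' _).const_mul _), integral_const_mul, integral_const_mul, integral_const_mul, integral_const_mul,
    integral_mul_fderivF_apply_eq_neg hu hw v, integral_mul_fderivF_apply_eq_neg hu hw (I • v)]
  ring

/-- The symmetric form: `∫ (∂̄_v u) w d vol = -∫ u ∂̄_v w d vol` for `u` a test function and `w`
smooth. [cite: HormanderSCV1973, §4.2 p. 83] -/
theorem integral_dbar_mul_eq_neg (hu : IsTest u) (hw : ContMDiff 𝓘(ℝ, ι → ℂ) 𝓘(ℝ, ℂ) ∞ w) (v : ι → ℂ) :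
    ∫ x, dbar v u x * w x ∂D.vol = -∫ x, u x * dbar v w x ∂D.vol := by
  have h := integral_mul_dbar_eq_neg hw hu v
  have e1 : (fun x ↦ dbar v u x * w x) = fun x ↦ w x * dbar v u x := funext fun x ↦ mul_comm _ _
  have e2 : (fun x ↦ u x * dbar v w x) = fun x ↦ dbar v w x * u x := funext fun x ↦ mul_comm _ _
  rw [e1, e2, h]

end IBP

/-! ### Chart transport of test functions -/

section Transport

variable {e : OpenPartialHomeomorph D (ι → ℂ)}

/-- **Transport from `ℂ^ι` to `D`.** Let `e` be a local inverse of `proj` and `W : ℂ^ι → G` a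
`C^∞` function with compact support inside `e.target`. Then the function
`e.source.indicator (W ∘ proj)` (i.e. `W ∘ proj` on `e.source`, `0` elsewhere) is a test function on
`D` with support inside `e.source`. [folklore] -/
theorem isTest_indicator_comp_proj (he : ⇑e = D.proj) {W : (ι → ℂ) → G} (hW : ContDiff ℝ ∞ W)
    (hWc : HasCompactSupport W) (hWe : tsupport W ⊆ e.target) :
    IsTest (e.source.indicator (W ∘ D.proj)) ∧ tsupport (e.source.indicator (W ∘ D.proj)) ⊆ e.source := by
  -- the compact set `K = e⁻¹(tsupport W) ⊆ e.source` carries the support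
  set K : Set D := e.symm '' tsupport W with hK
  have hKc : IsCompact K := (hWc.isCompact).image_of_continuousOn (e.continuousOn_symm.mono hWe)
  have hKsrc : K ⊆ e.source := by
    rintro _ ⟨z, hz, rfl⟩
    exact e.map_target (hWe hz)
  have hKcl : IsClosed K := hKc.isClosed
  set w : D → G := e.source.indicator (W ∘ D.proj) with hw
  have hsupp : support w ⊆ K := by
    intro x hx
    rw [mem_support] at hx
    by_cases hxs : x ∈ e.source
    · have hx' : W (D.proj x) ≠ 0 := by rwa [hw, indicator_of_mem hxs] at hx
      have hz : D.proj x ∈ tsupport W := subset_tsupport _ (mem_support.2 hx')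
      refine ⟨D.proj x, hz, ?_⟩
      rw [← he]
      exact e.left_inv hxs
    · exact (hx (by rw [hw, indicator_of_notMem hxs])).elim
  have htsupp : tsupport w ⊆ K := closure_minimal hsupp hKcl
  refine ⟨⟨?_, ?_⟩, htsupp.trans hKsrc⟩
  · intro x
    by_cases hxs : x ∈ e.source
    · -- near a point of the source, `w = W ∘ proj`
      have hloc : w =ᶠ[𝓝 x] W ∘ D.proj := by
        filter_upwards [e.open_source.mem_nhds hxs] with y hy
        rw [hw, indicator_of_mem hy]
      exact ((contMDiff_comp_proj (D := D) hW) x).congr_of_eventuallyEq hloc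
    · -- off the source we are off `K`, where `w = 0` near `x`
      have hxK : x ∉ K := fun h ↦ hxs (hKsrc h)
      have hloc : w =ᶠ[𝓝 x] fun _ ↦ 0 := by
        filter_upwards [hKcl.isOpen_compl.mem_nhds hxK] with y hy
        exact notMem_support.1 fun h ↦ hy (hsupp h)
      exact contMDiffAt_const.congr_of_eventuallyEq hloc
  · exact HasCompactSupport.intro hKc fun x hx ↦ notMem_support.1 fun h ↦ hx (hsupp h)

omit [NormedSpace ℂ G] in
/-- The transported function is `W ∘ proj` on `e.source`. [folklore] -/
theorem indicator_comp_proj_of_mem {W : (ι → ℂ) → G} {x : D} (hx : x ∈ e.source) :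
    e.source.indicator (W ∘ D.proj) x = W (D.proj x) := by
  rw [indicator_of_mem hx]; rfl

omit [NormedSpace ℂ G] in
/-- The transported function read back in the chart is `W` on `e.target`. [folklore] -/
theorem indicator_comp_proj_symm (he : ⇑e = D.proj) {W : (ι → ℂ) → G} {z : ι → ℂ} (hz : z ∈ e.target) :
    e.source.indicator (W ∘ D.proj) (e.symm z) = W z := by
  rw [indicator_of_mem (e.map_target hz)]
  show W (D.proj (e.symm z)) = W z
  rw [D.proj_symm_apply he hz]

omit [NormedSpace ℂ G] in
/-- The transported function read back in the chart is `W` on `e.target` (as functions: the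
extension by zero of its representative is `W`, when `tsupport W ⊆ e.target`). [folklore] -/
theorem indicator_comp_symm_indicator_comp_proj (he : ⇑e = D.proj) {W : (ι → ℂ) → G}
    (hWe : tsupport W ⊆ e.target) :
    e.target.indicator (e.source.indicator (W ∘ D.proj) ∘ e.symm) = W := by
  funext z
  by_cases hz : z ∈ e.target
  · rw [indicator_of_mem hz]
    exact indicator_comp_proj_symm he hz
  · rw [indicator_of_notMem hz]
    exact (image_eq_zero_of_notMem_tsupport fun h ↦ hz (hWe h)).symm

/-- **Derivative dictionary** (`ℂ^ι → D`): for `z ∈ e.target`, the flat derivative of the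
transported function at `e⁻¹ z` is the Euclidean derivative of `W` at `z`. [folklore] -/
theorem fderivF_indicator_comp_proj (he : ⇑e = D.proj) (W : (ι → ℂ) → G) {z : ι → ℂ} (hz : z ∈ e.target) :
    fderivF (e.source.indicator (W ∘ D.proj)) (e.symm z) = fderiv ℝ W z := by
  rw [fderivF_eq he (e.map_target hz), D.proj_symm_apply he hz]
  -- on the open set `e.target` the representative is `W`
  refine Filter.EventuallyEq.fderiv_eq ?_
  filter_upwards [e.open_target.mem_nhds hz] with z' hz'
  exact indicator_comp_proj_symm he hz'

/-- `∂̄_v` of the transported function at `e⁻¹ z` is `dbarAlong v W z`. [folklore] -/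
theorem dbar_indicator_comp_proj (he : ⇑e = D.proj) (W : (ι → ℂ) → G) {z : ι → ℂ} (hz : z ∈ e.target) (v : ι → ℂ) :
    dbar v (e.source.indicator (W ∘ D.proj)) (e.symm z) = dbarAlong v W z := by
  rw [dbar_eq_fderivF, fderivF_indicator_comp_proj he W hz, dbarAlong_apply]

/-- `∂_v` of the transported function at `e⁻¹ z` is `delAlong v W z`. [folklore] -/
theorem del_indicator_comp_proj (he : ⇑e = D.proj) (W : (ι → ℂ) → G) {z : ι → ℂ} (hz : z ∈ e.target) (v : ι → ℂ) :
    del v (e.source.indicator (W ∘ D.proj)) (e.symm z) = delAlong v W z := by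
  rw [del_eq_fderivF, fderivF_indicator_comp_proj he W hz, delAlong]

/-- **Transport from `D` to `ℂ^ι`** (restated from `RiemannDomainMeasure`): a test function with
support inside `e.source` reads as a `C^∞` compactly supported function on `ℂ^ι` with support
inside `e.target`. [folklore] -/
theorem IsTest.contDiff_indicator_comp_symm (he : ⇑e = D.proj) {g : D → G} (hg : IsTest g)
    (hge : tsupport g ⊆ e.source) :
    ContDiff ℝ ∞ (e.target.indicator (g ∘ e.symm)) ∧ HasCompactSupport (e.target.indicator (g ∘ e.symm)) ∧
      tsupport (e.target.indicator (g ∘ e.symm)) ⊆ e.target :=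
  RiemannDomain.contDiff_indicator_comp_symm he hg.contMDiff hg.hasCompactSupport hge

omit [NormedSpace ℂ G] in
/-- A function supported in `e.source` is recovered from its representative:
`g = e.source.indicator ((e.target.indicator (g ∘ e⁻¹)) ∘ proj)`. [folklore] -/
theorem indicator_comp_proj_indicator_comp_symm (he : ⇑e = D.proj) {g : D → G} (hge : support g ⊆ e.source) :
    e.source.indicator (e.target.indicator (g ∘ e.symm) ∘ D.proj) = g := by
  funext x
  by_cases hx : x ∈ e.source
  · rw [indicator_of_mem hx, comp_apply, indicator_of_mem (by rw [← he]; exact e.map_source hx)]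
    show g (e.symm (D.proj x)) = g x
    rw [← he, e.left_inv hx]
  · rw [indicator_of_notMem hx]
    exact (notMem_support.1 fun h ↦ hx (hge h)).symm

/-- **Derivative dictionary** (`D → ℂ^ι`): for a test function `g` supported in `e.source` and
`z ∈ e.target`, `fderivF g (e⁻¹ z)` is the Euclidean derivative at `z` of the extension by zero of
`g ∘ e⁻¹`. [folklore] -/
theorem fderivF_symm_eq_fderiv_indicator (he : ⇑e = D.proj) {g : D → G} {z : ι → ℂ} (hz : z ∈ e.target) :
    fderivF g (e.symm z) = fderiv ℝ (e.target.indicator (g ∘ e.symm)) z := by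
  rw [fderivF_eq he (e.map_target hz), D.proj_symm_apply he hz]
  refine Filter.EventuallyEq.fderiv_eq ?_
  filter_upwards [e.open_target.mem_nhds hz] with z' hz'
  rw [indicator_of_mem hz']

/-- `∂̄_v g (e⁻¹ z) = dbarAlong v (extension by zero of g ∘ e⁻¹) z` for `z ∈ e.target`. [folklore] -/
theorem dbar_symm_eq_dbarAlong_indicator (he : ⇑e = D.proj) {g : D → G} {z : ι → ℂ} (hz : z ∈ e.target)
    (v : ι → ℂ) : dbar v g (e.symm z) = dbarAlong v (e.target.indicator (g ∘ e.symm)) z := by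
  rw [dbar_eq_fderivF, fderivF_symm_eq_fderiv_indicator he hz, dbarAlong_apply]

/-- `∂_v g (e⁻¹ z) = delAlong v (extension by zero of g ∘ e⁻¹) z` for `z ∈ e.target`. [folklore] -/
theorem del_symm_eq_delAlong_indicator (he : ⇑e = D.proj) {g : D → G} {z : ι → ℂ} (hz : z ∈ e.target)
    (v : ι → ℂ) : del v g (e.symm z) = delAlong v (e.target.indicator (g ∘ e.symm)) z := by
  rw [del_eq_fderivF, fderivF_symm_eq_fderiv_indicator he hz, delAlong]

end Transport

/-! ### Smooth cut-offs -/

section Cutoff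

/-- **Smooth cut-offs**: for a compact `K` inside an open `U ⊆ D` there is a `C^∞` function
`χ : D → ℝ` with compact support inside `U`, `0 ≤ χ ≤ 1`, and `χ = 1` on a neighbourhood of `K`.
[folklore] -/
theorem exists_contMDiff_cutoff {K U : Set D} (hK : IsCompact K) (hU : IsOpen U) (hKU : K ⊆ U) :
    ∃ χ : D → ℝ, ContMDiff 𝓘(ℝ, ι → ℂ) 𝓘(ℝ, ℝ) ∞ χ ∧ HasCompactSupport χ ∧ tsupport χ ⊆ U ∧
      (∀ x, χ x ∈ Icc (0 : ℝ) 1) ∧ ∀ᶠ x in 𝓝ˢ K, χ x = 1 := by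
  -- `K ⊆ V ⊆ V̄ ⊆ W ⊆ W̄ ⊆ U` with `V̄`, `W̄` compact
  obtain ⟨W, hWo, hKW, hWU, hWc⟩ := exists_open_between_and_isCompact_closure hK hU hKU
  obtain ⟨V, hVo, hKV, hVW, hVc⟩ := exists_open_between_and_isCompact_closure hK hWo hKW
  -- a smooth function `= 0` off `W` and `= 1` on `V̄`
  obtain ⟨f, hf0, hf1, hf01⟩ := exists_contMDiffMap_zero_one_of_isClosed 𝓘(ℝ, ι → ℂ) (n := (⊤ : ℕ∞))
    hWo.isClosed_compl isClosed_closure (disjoint_compl_left_iff_subset.2 hVW)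
  refine ⟨f, f.contMDiff, ?_, ?_, hf01, ?_⟩
  · refine HasCompactSupport.intro' hWc isClosed_closure fun x hx ↦ hf0 ?_
    exact fun h ↦ hx (subset_closure h)
  · refine (closure_minimal (fun x hx ↦ ?_) isClosed_closure).trans hWU
    by_contra h
    exact hx (hf0 fun h' ↦ h (subset_closure h'))
  · exact eventually_of_mem (hVo.mem_nhdsSet.2 hKV) fun x hx ↦ hf1 (subset_closure hx)

/-- **Smooth cut-offs equal to `1` on a compact set**: there is a real test function `χ` with
`0 ≤ χ ≤ 1` and `χ = 1` on a neighbourhood of `K`. [folklore] -/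
theorem exists_cutoff_eq_one {K : Set D} (hK : IsCompact K) :
    ∃ χ : D → ℝ, ContMDiff 𝓘(ℝ, ι → ℂ) 𝓘(ℝ, ℝ) ∞ χ ∧ HasCompactSupport χ ∧
      (∀ x, χ x ∈ Icc (0 : ℝ) 1) ∧ ∀ᶠ x in 𝓝ˢ K, χ x = 1 := by
  obtain ⟨χ, h1, h2, -, h4, h5⟩ := exists_contMDiff_cutoff hK isOpen_univ (subset_univ K)
  exact ⟨χ, h1, h2, h4, h5⟩

/-- **An exhausting sequence of cut-offs**: real `C^∞` compactly supported `χ_k : D → [0, 1]` such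
that every compact set lies, for all large `k`, in the open set where `χ_k = 1`. [folklore] -/
theorem exists_cutoff_seq :
    ∃ χ : ℕ → D → ℝ, (∀ k, ContMDiff 𝓘(ℝ, ι → ℂ) 𝓘(ℝ, ℝ) ∞ (χ k)) ∧ (∀ k, HasCompactSupport (χ k)) ∧
      (∀ k x, χ k x ∈ Icc (0 : ℝ) 1) ∧
      ∀ K : Set D, IsCompact K → ∀ᶠ k in atTop, ∀ᶠ x in 𝓝ˢ K, χ k x = 1 := by
  set E : CompactExhaustion D := CompactExhaustion.choice D
  choose χ hχs hχc hχ01 hχ1 using fun k ↦ exists_cutoff_eq_one (D := D) (E.isCompact k)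
  refine ⟨χ, hχs, hχc, hχ01, fun K hK ↦ ?_⟩
  obtain ⟨k₀, hk₀⟩ := E.exists_superset_of_isCompact hK
  filter_upwards [eventually_ge_atTop k₀] with k hk
  exact (hχ1 k).filter_mono (nhdsSet_mono (hk₀.trans (E.subset hk)))

end Cutoff

/-! ### Density of test functions in `L^p(D, μ)` -/

section Density

/-- A Riemann domain is metrizable (regular and second countable). [folklore] -/
instance instMetrizableSpace : TopologicalSpace.MetrizableSpace D :=
  TopologicalSpace.metrizableSpace_of_t3_secondCountable D

variable {μ : Measure D} [IsFiniteMeasureOnCompacts μ] {p : ENNReal}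

omit [NormedSpace ℂ G] in
/-- **Smoothing a continuous compactly supported function in `L^p`**: for `g : D → G` continuous
with compact support, `p < ∞` and `ε ≠ 0` there is a `C^∞` function `φ` with
`support φ ⊆ support g` (so compact support) and `‖g - φ‖_{L^p(μ)} ≤ ε` (uniform approximation,
Mathlib `Continuous.exists_contMDiff_approx`, on the support of finite measure).
[cite: HormanderSCV1973, §4.1 (p. 77)] -/
theorem exists_contMDiff_eLpNorm_sub_le_of_continuous [NormedSpace ℝ G] (hp' : p ≠ ⊤) {g : D → G}
    (hg : Continuous g) (hgc : HasCompactSupport g) {ε : ENNReal} (hε : ε ≠ 0) :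
    ∃ φ : D → G, ContMDiff 𝓘(ℝ, ι → ℂ) 𝓘(ℝ, G) ∞ φ ∧ support φ ⊆ support g ∧ eLpNorm (g - φ) p μ ≤ ε := by
  rcases eq_or_ne ε ⊤ with rfl | hεtop
  · obtain ⟨φ, -, hφs⟩ := hg.exists_contMDiff_approx 𝓘(ℝ, ι → ℂ) ⊤ continuous_const (fun _ ↦ zero_lt_one)
    exact ⟨φ, φ.contMDiff, hφs, le_top⟩
  -- the support has finite measure `c`; choose the uniform precision `ε'` with `ε' c^{1/p} ≤ ε`
  set K : Set D := tsupport g with hK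
  have hKc : IsCompact K := hgc
  have hKm : MeasurableSet K := (isClosed_tsupport g).measurableSet
  have hcK : μ K ≠ ⊤ := hKc.measure_lt_top.ne
  set M : ENNReal := μ K ^ (1 / p.toReal) with hM
  have hMtop : M ≠ ⊤ := ENNReal.rpow_ne_top_of_nonneg (by positivity) hcK
  have hM1 : M + 1 ≠ 0 := by simp
  have hM1top : M + 1 ≠ ⊤ := ENNReal.add_ne_top.2 ⟨hMtop, ENNReal.one_ne_top⟩
  set δ : ENNReal := ε / (M + 1) with hδ
  have hδ0 : δ ≠ 0 := (ENNReal.div_pos hε hM1top).ne'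
  have hδtop : δ ≠ ⊤ := ENNReal.div_ne_top hεtop hM1
  have hδr : 0 < δ.toReal := ENNReal.toReal_pos hδ0 hδtop
  obtain ⟨φ, hφd, hφs⟩ := hg.exists_contMDiff_approx 𝓘(ℝ, ι → ℂ) ⊤ continuous_const (fun _ ↦ hδr)
  refine ⟨φ, φ.contMDiff, hφs, ?_⟩
  have hbd : ∀ x, dist (g x) (φ x) ≤ δ.toReal := fun x ↦ by rw [dist_comm]; exact (hφd x).le
  have h1 := eLpNorm_sub_le_of_dist_bdd μ hp' hKm hδr.le hbd (subset_tsupport g)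
    (hφs.trans (subset_tsupport g))
  refine h1.trans ?_
  rw [ENNReal.ofReal_toReal hδtop, hδ, ← hM]
  calc ε / (M + 1) * M ≤ ε / (M + 1) * (M + 1) := by gcongr; exact le_self_add
    _ = ε := ENNReal.div_mul_cancel hM1 hM1top

/-- **Test functions are dense in `L^p(D, μ)`** for every measure `μ` finite on compact sets and
`1 ≤ p < ∞` (Hörmander p. 77: «`D_{(p,q)}(Ω)` is dense in `L²_{(p,q)}(Ω, φ)`»): for `f ∈ L^p` and
`ε ≠ 0` there is a test function `φ` with `‖f - φ‖_{L^p(μ)} ≤ ε`. The measure is regular (`D` is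
metrizable and σ-compact), so continuous compactly supported functions are dense (Mathlib), and
those are smoothed by `exists_contMDiff_eLpNorm_sub_le_of_continuous`.
[cite: HormanderSCV1973, §4.1 (p. 77)] -/
theorem exists_isTest_eLpNorm_sub_le (hp : 1 ≤ p) (hp' : p ≠ ⊤) {f : D → G} (hf : MemLp f p μ)
    {ε : ENNReal} (hε : ε ≠ 0) : ∃ φ : D → G, IsTest φ ∧ eLpNorm (f - φ) p μ ≤ ε := by
  letI : NormedSpace ℝ G := NormedSpace.complexToReal
  have hε2 : ε / 2 ≠ 0 := (ENNReal.half_pos hε).ne'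
  obtain ⟨g, hgc, hgε, hg, hgp⟩ := hf.exists_hasCompactSupport_eLpNorm_sub_le hp' hε2
  obtain ⟨φ, hφs, hφsupp, hφε⟩ := exists_contMDiff_eLpNorm_sub_le_of_continuous (μ := μ) hp' hg hgc hε2
  have hφ : IsTest φ := ⟨hφs, hgc.mono hφsupp⟩
  refine ⟨φ, hφ, ?_⟩
  have hsplit : f - φ = (f - g) + (g - φ) := by abel
  rw [hsplit]
  refine (eLpNorm_add_le (hf.aestronglyMeasurable.sub hgp.aestronglyMeasurable)
    (hgp.aestronglyMeasurable.sub hφ.continuous.aestronglyMeasurable) hp).trans ?_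
  calc eLpNorm (f - g) p μ + eLpNorm (g - φ) p μ ≤ ε / 2 + ε / 2 := add_le_add hgε hφε
    _ = ε := ENNReal.add_halves ε

/-- Sequential form: for `f ∈ L^p(D, μ)`, `1 ≤ p < ∞`, there are test functions `φ_k` with
`‖f - φ_k‖_{L^p(μ)} → 0`. [cite: HormanderSCV1973, §4.1 (p. 77)] -/
theorem exists_isTest_tendsto_eLpNorm_sub (hp : 1 ≤ p) (hp' : p ≠ ⊤) {f : D → G} (hf : MemLp f p μ) :
    ∃ φ : ℕ → D → G, (∀ k, IsTest (φ k)) ∧ Tendsto (fun k ↦ eLpNorm (f - φ k) p μ) atTop (𝓝 0) := by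
  have hpos : ∀ k : ℕ, ((k : ENNReal) + 1)⁻¹ ≠ 0 := fun k ↦ by simp
  choose φ hφ hφε using fun k : ℕ ↦ exists_isTest_eLpNorm_sub_le hp hp' hf (hpos k)
  refine ⟨φ, hφ, ?_⟩
  have hlim : Tendsto (fun k : ℕ ↦ ((k : ENNReal) + 1)⁻¹) atTop (𝓝 0) := by
    have := ENNReal.tendsto_inv_nat_nhds_zero.comp (tendsto_add_atTop_nat 1)
    refine this.congr fun n ↦ ?_
    simp only [comp_apply, Nat.cast_add, Nat.cast_one]
  exact tendsto_of_tendsto_of_tendsto_of_le_of_le tendsto_const_nhds hlim (fun _ ↦ bot_le) hφε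

end Density

end RiemannDomain

end Literature.Analysis.Complex
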